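import Mathlib
import HarnessLib
import Summits.Ventures.LatticeQCDFlow.Exactness.SUNResidualLayerContraction
import Summits.Ventures.LatticeQCDFlow.Scaling.EntropyBudgetCoupling

/-!
# The masked `SU(N)` residual layer is a homeomorphism of configuration space, hence a measurable bijection with measurable inverse: coupling layers with bijective fibres

HONEST FRAMING: exact (Metropolis-corrected) sampling algorithms for lattice gauge theory;
figures of merit are autocorrelation/cost numbers at stated couplings and volumes; no
continuum-physics claim.

Venture `LatticeQCDFlow` (cell pub-lqcd), topic `Exactness`; FANOUT row 10 (`eng-equiv`, engine
`latflow.equiv`, module `equiv/residual.py` — `ResidualCoupling.forward` / `.inverse`: "Map on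
ACTIVE links … (direction coupling + site mask; all staples must consist of frozen links)",
"Layer log-det = sum over active links (triangular coupling)"; `flows_jax.residual_flow`).  NEW
WORK of the cell over `SUNResidualLayerContraction.lean` (one active link: unique pre-image and
two-sided Lipschitz bounds under the `κ < 1` certificate) and row 31's `Theory2.coupleFun`
(`Scaling/EntropyBudgetCoupling.lean`: coupling layers on `ι → G`, `measurable_coupleFun`,
`coupleEquiv` for fibres given as measurable equivalences); nothing is cited as a fact; no number;
no definition is introduced.  Printed counterparts, NAMED ONLY: Abbott et al., arXiv:2305.02402
§4.2; Dinh et al., *Density estimation using Real NVP*, ICLR 2017 (coupling layers are invertible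
iff their fibres are).

## What is typed

* coupling layers, any coordinate type `G` (pure combinatorics of `Theory2.coupleFun`):
  **`coupleFun_injective_of_fibre`**, **`coupleFun_surjective_of_fibre`**,
  **`coupleFun_bijective_of_fibre`** — a coupling layer whose single-coordinate maps `ψ a y`
  are injective / surjective / bijective for every active coordinate `a` and frozen part `y` is
  injective / surjective / bijective on `ι → G` (the frozen part is read off the image, then each
  active coordinate is inverted in its own fibre); `continuous_coupleFun` — jointly continuous
  fibres give a continuous layer; **`isHomeomorph_coupleFun`** — on a compact Hausdorff `G`,
  bijective + continuous fibres give a HOMEOMORPHISM of `ι → G`;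
  **`exists_measurableEquiv_coupleFun`** — hence (Borel, second countable, countable `ι`) a
  measurable equivalence whose forward map IS the layer: the object row 31's exactness /
  entropy-budget theorems and `HasJacobian.map_withDensity_equiv` consume;
* the engine's masked residual layer on `ι → SU(n)`, every `n`: fibres
  `u ↦ e^{Q a y (u)} u` with exponents `Q a y : SU(n) → 𝔰𝔲(n)` read from the frozen links,
  `κ a y`-Lipschitz (Frobenius) with `κ a y < 1` — **`sunResidualLayer_bijective`** (from
  `residualLayer_bijective` fibrewise); with `(y, u) ↦ Q a y u` jointly continuous,
  `continuous_sunResidualFibre`, **`isHomeomorph_sunResidualLayer`** and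
  **`exists_measurableEquiv_sunResidualLayer`**: the layer is a homeomorphism of `SU(n)^ι` and a
  measurable bijection with measurable inverse — the standing "bijective transport map"
  hypothesis of the flow-sampler exactness files, for the learned `SU(N)` residual layers.

NOT here: the Jacobian of the layer; lattice masks (which links are frozen is the datum `p`; that
the engine's direction/location masks freeze every staple is `KernelCouplingMask.lean`'s kind of
statement); any number.
-/

noncomputable section

namespace Summit.Ventures.LatticeQCDFlow.Exactness

open Literature.MathematicalPhysics.QuantumFieldTheory
open Literature.MathematicalPhysics.QuantumFieldTheory.Luscher2010
open scoped Matrix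

/-! ## Coupling layers with injective / surjective / bijective fibres -/

section Couple

variable {ι : Type*} {p : ι → Prop} [DecidablePred p] {G : Type*}

/-- **Injective fibres ⟹ injective layer.**  If every single-coordinate map `ψ a y` is
injective, the coupling layer is injective: equal images have equal frozen parts (the layer does
not touch them), hence equal fibre maps, hence equal active coordinates. -/
theorem coupleFun_injective_of_fibre {ψ : {i // p i} → ({i // ¬p i} → G) → G → G}
    (hψ : ∀ a y, Function.Injective (ψ a y)) : Function.Injective (Theory2.coupleFun p ψ) := by
  intro U V hUV
  have hfrozen : (fun f : {i // ¬p i} => U f) = fun f : {i // ¬p i} => V f := by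
    rw [← Theory2.coupleFun_frozen ψ U, ← Theory2.coupleFun_frozen ψ V, hUV]
  funext i
  by_cases hi : p i
  · have h := congrFun hUV i
    rw [Theory2.coupleFun_apply_of_pos ψ U hi, Theory2.coupleFun_apply_of_pos ψ V hi, hfrozen] at h
    exact hψ ⟨i, hi⟩ _ h
  · exact congrFun hfrozen ⟨i, hi⟩

/-- **Surjective fibres ⟹ surjective layer.**  Given a target `W`, read the frozen part `y` off
`W`, choose in each active fibre a pre-image of `W a` under `ψ a y`, and keep `W` elsewhere. -/
theorem coupleFun_surjective_of_fibre {ψ : {i // p i} → ({i // ¬p i} → G) → G → G}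
    (hψ : ∀ a y, Function.Surjective (ψ a y)) : Function.Surjective (Theory2.coupleFun p ψ) := by
  classical
  intro W
  have hex : ∀ a : {i // p i}, ∃ u : G, ψ a (fun f : {i // ¬p i} => W f) u = W a :=
    fun a => hψ a _ (W a)
  choose u hu using hex
  refine ⟨fun i => if hi : p i then u ⟨i, hi⟩ else W i, ?_⟩
  have hfrozen : (fun f : {i // ¬p i} => (fun i => if hi : p i then u ⟨i, hi⟩ else W i) (f : ι)) =
      fun f : {i // ¬p i} => W f := by
    funext f
    simp only [dif_neg f.2]
  funext i
  by_cases hi : p i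
  · rw [Theory2.coupleFun_apply_of_pos ψ _ hi, hfrozen]
    simp only [dif_pos hi]
    exact hu ⟨i, hi⟩
  · rw [Theory2.coupleFun_apply_of_neg ψ _ hi]
    simp only [dif_neg hi]

/-- **Bijective fibres ⟹ bijective layer** (coupling layers are invertible exactly fibrewise). -/
theorem coupleFun_bijective_of_fibre {ψ : {i // p i} → ({i // ¬p i} → G) → G → G}
    (hψ : ∀ a y, Function.Bijective (ψ a y)) : Function.Bijective (Theory2.coupleFun p ψ) :=
  ⟨coupleFun_injective_of_fibre fun a y => (hψ a y).1,
    coupleFun_surjective_of_fibre fun a y => (hψ a y).2⟩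

variable [TopologicalSpace G]

/-- **Jointly continuous fibres ⟹ continuous layer** (`(u, y) ↦ ψ a y u` continuous for each
active `a`). -/
theorem continuous_coupleFun {ψ : {i // p i} → ({i // ¬p i} → G) → G → G}
    (hψ : ∀ a, Continuous fun q : G × ({i // ¬p i} → G) => ψ a q.2 q.1) :
    Continuous (Theory2.coupleFun p ψ) := by
  refine continuous_pi fun i => ?_
  by_cases hi : p i
  · have heq : (fun U : ι → G => Theory2.coupleFun p ψ U i) =
        (fun q : G × ({i // ¬p i} → G) => ψ ⟨i, hi⟩ q.2 q.1) ∘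
          fun U : ι → G => (U i, fun f : {i // ¬p i} => U f) := by
      funext U
      simp only [Function.comp_apply, Theory2.coupleFun_apply_of_pos ψ U hi]
    rw [heq]
    exact (hψ ⟨i, hi⟩).comp
      ((continuous_apply i).prodMk (continuous_pi fun f => continuous_apply (f : ι)))
  · have heq : (fun U : ι → G => Theory2.coupleFun p ψ U i) = fun U => U i := by
      funext U
      exact Theory2.coupleFun_apply_of_neg ψ U hi
    rw [heq]
    exact continuous_apply i

variable [CompactSpace G] [T2Space G]

/-- **On a compact Hausdorff coordinate space, bijective continuous fibres give a HOMEOMORPHISM**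
of `ι → G` (a continuous bijection of a compact space onto a Hausdorff space). -/
theorem isHomeomorph_coupleFun {ψ : {i // p i} → ({i // ¬p i} → G) → G → G}
    (hψb : ∀ a y, Function.Bijective (ψ a y))
    (hψc : ∀ a, Continuous fun q : G × ({i // ¬p i} → G) => ψ a q.2 q.1) :
    IsHomeomorph (Theory2.coupleFun p ψ) :=
  isHomeomorph_iff_continuous_bijective.mpr ⟨continuous_coupleFun hψc, coupleFun_bijective_of_fibre hψb⟩

variable [MeasurableSpace G] [BorelSpace G] [SecondCountableTopology G] [Countable ι]

/-- **… hence a measurable equivalence whose forward map is the layer** (Borel structures): the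
layer is a measurable bijection with measurable inverse. -/
theorem exists_measurableEquiv_coupleFun {ψ : {i // p i} → ({i // ¬p i} → G) → G → G}
    (hψb : ∀ a y, Function.Bijective (ψ a y))
    (hψc : ∀ a, Continuous fun q : G × ({i // ¬p i} → G) => ψ a q.2 q.1) :
    ∃ e : (ι → G) ≃ᵐ (ι → G), ⇑e = Theory2.coupleFun p ψ := by
  obtain ⟨h, hh⟩ := isHomeomorph_iff_exists_homeomorph.mp (isHomeomorph_coupleFun hψb hψc)
  exact ⟨h.toMeasurableEquiv, by rw [Homeomorph.toMeasurableEquiv_coe, hh]⟩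

end Couple

/-! ## The engine's masked residual layer on `ι → SU(n)` -/

section Residual

variable {n : ℕ} {ι : Type*} {p : ι → Prop} [DecidablePred p]

/-- **The masked residual layer is a bijection of `SU(n)^ι`, every `n`.**  Fibres
`u ↦ e^{Q a y (u)} u` with `Q a y : SU(n) → 𝔰𝔲(n)` (read from the frozen links `y`)
`κ a y`-Lipschitz in the Frobenius norm, `0 ≤ κ a y < 1` — the engine's per-active-link
certificate, checked by `ResidualCoupling.forward` before acting. -/
theorem sunResidualLayer_bijective
    (Q : {i // p i} → ({i // ¬p i} → Matrix.specialUnitaryGroup (Fin n) ℂ) →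
      Matrix (Fin n) (Fin n) ℂ → Matrix (Fin n) (Fin n) ℂ)
    (κ : {i // p i} → ({i // ¬p i} → Matrix.specialUnitaryGroup (Fin n) ℂ) → ℝ)
    (hQ : ∀ a y, ∀ U ∈ Matrix.specialUnitaryGroup (Fin n) ℂ, (Q a y U)ᴴ = -Q a y U ∧ (Q a y U).trace = 0)
    (hlip : ∀ a y, ∀ U ∈ Matrix.specialUnitaryGroup (Fin n) ℂ, ∀ V ∈ Matrix.specialUnitaryGroup (Fin n) ℂ,
      frobNorm (Q a y U - Q a y V) ≤ κ a y * frobNorm (U - V))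
    (hκ0 : ∀ a y, 0 ≤ κ a y) (hκ : ∀ a y, κ a y < 1) :
    Function.Bijective (Theory2.coupleFun p fun a y (u : Matrix.specialUnitaryGroup (Fin n) ℂ) =>
      (⟨NormedSpace.exp (Q a y u) * u, residual_value_mem (hQ a y) u.2⟩ :
        Matrix.specialUnitaryGroup (Fin n) ℂ)) :=
  coupleFun_bijective_of_fibre fun a y => residualLayer_bijective (hκ0 a y) (hκ a y) (hQ a y) (hlip a y)

/-- `X ↦ e^X` is continuous on `Matrix (Fin n) (Fin n) ℂ` (Mathlib's `NormedSpace.exp_continuous`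
in the `ℓ²`-operator norm; the topology is the product topology whatever the norm). -/
theorem continuous_matrix_exp : Continuous fun X : Matrix (Fin n) (Fin n) ℂ => NormedSpace.exp X := by
  open scoped Matrix.Norms.L2Operator in
  letI : NormedAlgebra ℚ (Matrix (Fin n) (Fin n) ℂ) :=
    NormedAlgebra.restrictScalars ℚ ℂ (Matrix (Fin n) (Fin n) ℂ)
  exact NormedSpace.exp_continuous

/-- **The residual fibre is jointly continuous in (link, frozen context)** when the exponent is:
`(u, y) ↦ e^{Q y u} u` as a map into `SU(n)`. -/
theorem continuous_sunResidualFibre {Y : Type*} [TopologicalSpace Y]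
    {Q : Y → Matrix (Fin n) (Fin n) ℂ → Matrix (Fin n) (Fin n) ℂ}
    (hQ : ∀ y, ∀ U ∈ Matrix.specialUnitaryGroup (Fin n) ℂ, (Q y U)ᴴ = -Q y U ∧ (Q y U).trace = 0)
    (hQc : Continuous fun q : Matrix.specialUnitaryGroup (Fin n) ℂ × Y =>
      Q q.2 (q.1 : Matrix (Fin n) (Fin n) ℂ)) :
    Continuous fun q : Matrix.specialUnitaryGroup (Fin n) ℂ × Y =>
      (⟨NormedSpace.exp (Q q.2 q.1) * q.1, residual_value_mem (hQ q.2) q.1.2⟩ :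
        Matrix.specialUnitaryGroup (Fin n) ℂ) :=
  ((continuous_matrix_exp.comp hQc).mul (continuous_subtype_val.comp continuous_fst)).subtype_mk _

/-- **The masked residual layer is a HOMEOMORPHISM of `SU(n)^ι`** (compact Hausdorff factors;
bijective by the certificate, continuous by joint continuity of the exponents in
(link, frozen context)). -/
theorem isHomeomorph_sunResidualLayer
    (Q : {i // p i} → ({i // ¬p i} → Matrix.specialUnitaryGroup (Fin n) ℂ) →
      Matrix (Fin n) (Fin n) ℂ → Matrix (Fin n) (Fin n) ℂ)
    (κ : {i // p i} → ({i // ¬p i} → Matrix.specialUnitaryGroup (Fin n) ℂ) → ℝ)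
    (hQ : ∀ a y, ∀ U ∈ Matrix.specialUnitaryGroup (Fin n) ℂ, (Q a y U)ᴴ = -Q a y U ∧ (Q a y U).trace = 0)
    (hlip : ∀ a y, ∀ U ∈ Matrix.specialUnitaryGroup (Fin n) ℂ, ∀ V ∈ Matrix.specialUnitaryGroup (Fin n) ℂ,
      frobNorm (Q a y U - Q a y V) ≤ κ a y * frobNorm (U - V))
    (hκ0 : ∀ a y, 0 ≤ κ a y) (hκ : ∀ a y, κ a y < 1)
    (hQc : ∀ a, Continuous fun q : Matrix.specialUnitaryGroup (Fin n) ℂ ×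
      ({i // ¬p i} → Matrix.specialUnitaryGroup (Fin n) ℂ) => Q a q.2 (q.1 : Matrix (Fin n) (Fin n) ℂ)) :
    IsHomeomorph (Theory2.coupleFun p fun a y (u : Matrix.specialUnitaryGroup (Fin n) ℂ) =>
      (⟨NormedSpace.exp (Q a y u) * u, residual_value_mem (hQ a y) u.2⟩ :
        Matrix.specialUnitaryGroup (Fin n) ℂ)) :=
  isHomeomorph_coupleFun
    (fun a y => residualLayer_bijective (hκ0 a y) (hκ a y) (hQ a y) (hlip a y))
    fun a => continuous_sunResidualFibre (hQ a) (hQc a)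

/-- **… and a measurable bijection with measurable inverse** (countable link set, Borel
structures): there is a measurable equivalence of `SU(n)^ι` whose forward map IS the masked
residual layer. -/
theorem exists_measurableEquiv_sunResidualLayer [Countable ι]
    (Q : {i // p i} → ({i // ¬p i} → Matrix.specialUnitaryGroup (Fin n) ℂ) →
      Matrix (Fin n) (Fin n) ℂ → Matrix (Fin n) (Fin n) ℂ)
    (κ : {i // p i} → ({i // ¬p i} → Matrix.specialUnitaryGroup (Fin n) ℂ) → ℝ)
    (hQ : ∀ a y, ∀ U ∈ Matrix.specialUnitaryGroup (Fin n) ℂ, (Q a y U)ᴴ = -Q a y U ∧ (Q a y U).trace = 0)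
    (hlip : ∀ a y, ∀ U ∈ Matrix.specialUnitaryGroup (Fin n) ℂ, ∀ V ∈ Matrix.specialUnitaryGroup (Fin n) ℂ,
      frobNorm (Q a y U - Q a y V) ≤ κ a y * frobNorm (U - V))
    (hκ0 : ∀ a y, 0 ≤ κ a y) (hκ : ∀ a y, κ a y < 1)
    (hQc : ∀ a, Continuous fun q : Matrix.specialUnitaryGroup (Fin n) ℂ ×
      ({i // ¬p i} → Matrix.specialUnitaryGroup (Fin n) ℂ) => Q a q.2 (q.1 : Matrix (Fin n) (Fin n) ℂ)) :
    ∃ e : (ι → Matrix.specialUnitaryGroup (Fin n) ℂ) ≃ᵐ (ι → Matrix.specialUnitaryGroup (Fin n) ℂ),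
      ⇑e = Theory2.coupleFun p fun a y (u : Matrix.specialUnitaryGroup (Fin n) ℂ) =>
        (⟨NormedSpace.exp (Q a y u) * u, residual_value_mem (hQ a y) u.2⟩ :
          Matrix.specialUnitaryGroup (Fin n) ℂ) := by
  haveI : SecondCountableTopology (Matrix (Fin n) (Fin n) ℂ) :=
    inferInstanceAs (SecondCountableTopology (Fin n → Fin n → ℂ))
  haveI : SecondCountableTopology (Matrix.specialUnitaryGroup (Fin n) ℂ) :=
    Topology.IsEmbedding.subtypeVal.secondCountableTopology
  exact exists_measurableEquiv_coupleFun
    (fun a y => residualLayer_bijective (hκ0 a y) (hκ a y) (hQ a y) (hlip a y))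
    fun a => continuous_sunResidualFibre (hQ a) (hQc a)

end Residual

end Summit.Ventures.LatticeQCDFlow.Exactness
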